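import Literature.Probability.RandomPlanarGeometry.SAWPulledFreeEnergyConvex
import Literature.Probability.RandomPlanarGeometry.SAWPulledHalfSpaceFreeEnergy
import Literature.Probability.RandomPlanarGeometry.SAWHutchcroftTheorem12
import Literature.Probability.RandomPlanarGeometry.HammersleyWelshBound
import Mathlib.Analysis.Convex.Slope
import Mathlib.Analysis.Convex.Jensen
import Mathlib.Analysis.Convex.SpecificFunctions.Basic
import HarnessLib

/-!
# Pulled self-avoiding bridges: mean extension versus free-energy secants, and the zero-force slope

Topic `Literature/Probability/RandomPlanarGeometry` (continues `SAWPulledBridgeFreeEnergy.lean`: `λ_B(y) =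
lim N⁻¹ log Z^B_N(y)` (`Zd.pulledBridgeFreeEnergy`, Fekete), `SAWPulledFreeEnergyConvex.lean`: `s ↦ λ_B(e^s)` is
convex (`Zd.pulledBridgeFreeEnergy_exp_convexOn`, used here, not re-proved) and `SAWPulledHalfSpaceFreeEnergy.lean`:
`λ_B(1) = log μ`, `λ_B` monotone). Every `ℤ^{d+1}`, every force; standard axioms.

Sources. Beaton (2015) [cite: Beaton2015, §2 (λ(y), eq. (4)), Lemma 2] for the objects; Ioffe–Velenik, *Ballistic
phase of self-interacting random walks* (2008), §3 and Janse van Rensburg–Whittington (2016), §1 ("the free energy is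
a convex function of the force", "the average extension is the derivative of the free energy") for the thermodynamic
dictionary; Duminil-Copin–Hammond (2013), §2.4 for bridge non-ballisticity [cite: DuminilCopinHammond2013, §2.4].
The finite-volume statements below are the textbook Gibbs/Chernoff calculus for the one-parameter exponential family
`P^{B,y}_N(ω) ∝ y^{span ω}` on `N`-step bridges; what is NEW (not in print, searched: corpus fts+vec "pulled walk force
extension convex free energy bridge", galaxy "force-extension|pulled self-avoiding|zero force") is (i) the packaging as
two-sided SECANT inequalities that turn any pair of certified free-energy windows into a certified window for the
asymptotic extension per step (consumed by the companion file `SAWPulledExtensionStaircaseZ2`: the `ℤ²` staircase), and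
(ii) the equivalence «bridges are not ballistic (DC–H 2013, exponential form) ⟺ the right-derivative of
`s ↦ λ_B(e^s)` at zero force vanishes», i.e. Beaton's pulling transition at `y_c = 1` has no extension jump.

## Contents (namespace `Literature.Probability.RandomPlanarGeometry.SAW`)

§1 `ExpTilt` — a finite exponential family `Z(s) = Σ_{i∈S} w_i e^{a_i s}`, `w ≥ 0`: the supporting line
`(t - s)·M(s) ≤ log Z(t) - log Z(s)` (Gibbs–Jensen), convexity of `log Z`, monotone tilted mean, secant sandwich
`M(s) ≤ (log Z(t) - log Z(s))/(t - s) ≤ M(t)`, Chernoff tails.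
§2 `Zd` — pulled bridges: `Z^B_N(e^s)` is such a family (`a = span`, `pulledBridgeZ_exp_eq_tiltZ`); `pulledMeanSpan`
= `E^{B,y}_N[span]`, its supporting line `mul_pulledMeanSpan_le_log_sub` and monotonicity `pulledMeanSpan_mono`;
`pulledBridgeFreeEnergy_secant_mono(_left)` (from `Zd.pulledBridgeFreeEnergy_exp_convexOn`), the Lipschitz bound `λ_B(y') - λ_B(y) ≤ log y' - log y`, the finite-`N`
and eventual mean-extension sandwiches `(λ_B(y) - λ_B(y''))/(log y - log y'') - ε ≤ E^{B,y}_N[span]/N ≤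
(λ_B(y') - λ_B(y))/(log y' - log y) + ε` (`y'' < y < y'`, `N ≥ N₀(ε)`), window-to-secant lemmas
(`rightSecant_ge_of_window`, `leftSecant_le_of_window`, `log_cert_lower/upper`).
§3 zero force: `log μ ≤ λ_B(y)` (`y ≥ 1`), `zeroForce_secant_mono`; **`pulledBridgeFreeEnergy_exp_le_of_bridgeNotBallistic`**
(DC–H ⇒ `∀ v > 0 ∃ s₀ > 0 ∀ s ∈ [0,s₀], λ_B(e^s) ≤ log μ + v s`) and the converse
**`bridge_span_tail_le_exp`** / **`bridgeNotBallistic_of_zeroForceSlope`** (a vanishing zero-force slope forces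
exponential decay of `#{span ≥ v n}/b_n` for every `v > 0`).

Lane «pcv-sawmu», a-idea-1 gen 10 (R43 «FORCE-EXT» / R47 «ZERO-FORCE»), 2026-08-22.
-/

noncomputable section

open Finset Filter Topology Literature.Probability.LatticeModels
open Literature.Probability.RandomPlanarGeometry.SAW
open scoped BigOperators

namespace Literature.Probability.RandomPlanarGeometry.SAW

/-! ## §1 Finite exponential families: supporting line, convexity of `log Z`, monotone mean, Chernoff tails -/

namespace ExpTilt

variable {ι : Type*}

/-- `Z(s) = Σ_{i ∈ S} w_i e^{a_i s}`. [folklore] -/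
def tiltZ (S : Finset ι) (w a : ι → ℝ) (s : ℝ) : ℝ := ∑ i ∈ S, w i * Real.exp (a i * s)

/-- The tilted mean `M(s) = Z(s)⁻¹ Σ_{i ∈ S} w_i a_i e^{a_i s}`. [folklore] -/
def tiltMean (S : Finset ι) (w a : ι → ℝ) (s : ℝ) : ℝ :=
  (∑ i ∈ S, w i * a i * Real.exp (a i * s)) / tiltZ S w a s

/-- `Z(t) = Σ w_i e^{a_i s} · e^{(t-s) a_i}`. [cite: JansevanRensburgWhittington2016, §1] -/
theorem tiltZ_eq_sum_mul_exp (S : Finset ι) (w a : ι → ℝ) (s t : ℝ) :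
    tiltZ S w a t = ∑ i ∈ S, w i * Real.exp (a i * s) * Real.exp ((t - s) * a i) := by
  unfold tiltZ
  refine Finset.sum_congr rfl fun i _ => ?_
  rw [mul_assoc, ← Real.exp_add, show a i * s + (t - s) * a i = a i * t by ring]

/-- **Supporting line (Gibbs–Jensen)**: `(t - s)·M(s) ≤ log Z(t) - log Z(s)` — Jensen for `exp` under the tilted
weights `w_i e^{a_i s}/Z(s)`: `Z(t)/Z(s) = E_s[e^{(t-s)a}] ≥ e^{(t-s) E_s[a]}`. [cite: JansevanRensburgWhittington2016, §1] -/
theorem mul_tiltMean_le_log_sub (S : Finset ι) {w : ι → ℝ} (hw : ∀ i ∈ S, 0 ≤ w i) (a : ι → ℝ)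
    (hZ : ∀ s, 0 < tiltZ S w a s) (s t : ℝ) :
    (t - s) * tiltMean S w a s ≤ Real.log (tiltZ S w a t) - Real.log (tiltZ S w a s) := by
  have hZs := hZ s
  have hZt := hZ t
  have hπ0 : ∀ i ∈ S, 0 ≤ w i * Real.exp (a i * s) / tiltZ S w a s := fun i hi =>
    div_nonneg (mul_nonneg (hw i hi) (Real.exp_pos _).le) hZs.le
  have hπ1 : ∑ i ∈ S, w i * Real.exp (a i * s) / tiltZ S w a s = 1 := by
    rw [← Finset.sum_div]
    exact div_self hZs.ne'
  have hJ := (convexOn_exp).map_sum_le (p := fun i => (t - s) * a i) hπ0 hπ1 (fun i _ => Set.mem_univ _)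
  simp only [smul_eq_mul] at hJ
  have hL : ∑ i ∈ S, w i * Real.exp (a i * s) / tiltZ S w a s * ((t - s) * a i) =
      (t - s) * tiltMean S w a s := by
    rw [tiltMean, mul_div_assoc', Finset.mul_sum, Finset.sum_div]
    exact Finset.sum_congr rfl fun i _ => by ring
  have hR : ∑ i ∈ S, w i * Real.exp (a i * s) / tiltZ S w a s * Real.exp ((t - s) * a i) =
      tiltZ S w a t / tiltZ S w a s := by
    rw [tiltZ_eq_sum_mul_exp S w a s t, Finset.sum_div]
    exact Finset.sum_congr rfl fun i _ => by ring
  rw [hL, hR] at hJ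
  have h := (Real.le_log_iff_exp_le (div_pos hZt hZs)).2 hJ
  rwa [Real.log_div hZt.ne' hZs.ne'] at h

/-- **`log Z` is convex** (it has the supporting line of slope `M(s)` at every `s`). [cite: JansevanRensburgWhittington2016, §1] -/
theorem convexOn_log_tiltZ (S : Finset ι) {w : ι → ℝ} (hw : ∀ i ∈ S, 0 ≤ w i) (a : ι → ℝ)
    (hZ : ∀ s, 0 < tiltZ S w a s) : ConvexOn ℝ Set.univ fun s => Real.log (tiltZ S w a s) := by
  refine ⟨convex_univ, fun s₁ _ s₂ _ p q hp hq hpq => ?_⟩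
  obtain rfl : q = 1 - p := by linarith
  simp only [smul_eq_mul]
  set s : ℝ := p * s₁ + (1 - p) * s₂ with hs
  have h1 := mul_tiltMean_le_log_sub S hw a hZ s s₁
  have h2 := mul_tiltMean_le_log_sub S hw a hZ s s₂
  set E := tiltMean S w a s
  have h1' := mul_le_mul_of_nonneg_left h1 hp
  have h2' := mul_le_mul_of_nonneg_left h2 hq
  have hsum : p * ((s₁ - s) * E) + (1 - p) * ((s₂ - s) * E) = 0 := by rw [hs]; ring
  linarith

/-- Secant sandwich, lower end: `M(s) ≤ (log Z(t) - log Z(s))/(t - s)` for `s < t`. [cite: JansevanRensburgWhittington2016, §1] -/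
theorem tiltMean_le_secant (S : Finset ι) {w : ι → ℝ} (hw : ∀ i ∈ S, 0 ≤ w i) (a : ι → ℝ)
    (hZ : ∀ s, 0 < tiltZ S w a s) {s t : ℝ} (hst : s < t) :
    tiltMean S w a s ≤ (Real.log (tiltZ S w a t) - Real.log (tiltZ S w a s)) / (t - s) := by
  rw [le_div_iff₀ (sub_pos.2 hst), mul_comm]
  exact mul_tiltMean_le_log_sub S hw a hZ s t

/-- Secant sandwich, upper end: `(log Z(t) - log Z(s))/(t - s) ≤ M(t)` for `s < t`. [cite: JansevanRensburgWhittington2016, §1] -/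
theorem secant_le_tiltMean (S : Finset ι) {w : ι → ℝ} (hw : ∀ i ∈ S, 0 ≤ w i) (a : ι → ℝ)
    (hZ : ∀ s, 0 < tiltZ S w a s) {s t : ℝ} (hst : s < t) :
    (Real.log (tiltZ S w a t) - Real.log (tiltZ S w a s)) / (t - s) ≤ tiltMean S w a t := by
  rw [div_le_iff₀ (sub_pos.2 hst)]
  have h := mul_tiltMean_le_log_sub S hw a hZ t s
  linarith

/-- **The tilted mean is non-decreasing** (`M' = Var ≥ 0`, here from the two supporting lines). [cite: JansevanRensburgWhittington2016, §1] -/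
theorem tiltMean_mono (S : Finset ι) {w : ι → ℝ} (hw : ∀ i ∈ S, 0 ≤ w i) (a : ι → ℝ)
    (hZ : ∀ s, 0 < tiltZ S w a s) : Monotone (tiltMean S w a) := by
  intro s t hst
  rcases hst.lt_or_eq with h | h
  · exact (tiltMean_le_secant S hw a hZ h).trans (secant_le_tiltMean S hw a hZ h)
  · rw [h]

/-- **Chernoff upper tail**: `Σ_{a_i ≥ u} w_i e^{a_i s} ≤ e^{-(t-s)u} Z(t)` for `s ≤ t`. [cite: JansevanRensburgWhittington2016, §1] -/
theorem sum_filter_ge_le (S : Finset ι) {w : ι → ℝ} (hw : ∀ i ∈ S, 0 ≤ w i) (a : ι → ℝ) {s t : ℝ}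
    (hst : s ≤ t) (u : ℝ) :
    ∑ i ∈ S.filter (fun i => u ≤ a i), w i * Real.exp (a i * s) ≤ Real.exp (-((t - s) * u)) * tiltZ S w a t := by
  calc ∑ i ∈ S.filter (fun i => u ≤ a i), w i * Real.exp (a i * s)
      ≤ ∑ i ∈ S.filter (fun i => u ≤ a i), Real.exp (-((t - s) * u)) * (w i * Real.exp (a i * t)) := by
        refine Finset.sum_le_sum fun i hi => ?_
        obtain ⟨hiS, hiu⟩ := Finset.mem_filter.1 hi
        have hexp : Real.exp (a i * s) ≤ Real.exp (-((t - s) * u)) * Real.exp (a i * t) := by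
          rw [← Real.exp_add, Real.exp_le_exp]
          have := mul_le_mul_of_nonneg_left hiu (sub_nonneg.2 hst)
          linarith
        calc w i * Real.exp (a i * s) ≤ w i * (Real.exp (-((t - s) * u)) * Real.exp (a i * t)) :=
              mul_le_mul_of_nonneg_left hexp (hw i hiS)
          _ = Real.exp (-((t - s) * u)) * (w i * Real.exp (a i * t)) := by ring
    _ = Real.exp (-((t - s) * u)) * ∑ i ∈ S.filter (fun i => u ≤ a i), w i * Real.exp (a i * t) := by
        rw [Finset.mul_sum]
    _ ≤ Real.exp (-((t - s) * u)) * tiltZ S w a t := by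
        refine mul_le_mul_of_nonneg_left ?_ (Real.exp_pos _).le
        exact Finset.sum_le_sum_of_subset_of_nonneg (Finset.filter_subset _ S)
          fun i hi _ => mul_nonneg (hw i hi) (Real.exp_pos _).le

/-- **Chernoff lower tail**: `Σ_{a_i ≤ u} w_i e^{a_i s} ≤ e^{(s-t)u} Z(t)` for `t ≤ s`. [cite: JansevanRensburgWhittington2016, §1] -/
theorem sum_filter_le_le (S : Finset ι) {w : ι → ℝ} (hw : ∀ i ∈ S, 0 ≤ w i) (a : ι → ℝ) {s t : ℝ}
    (hts : t ≤ s) (u : ℝ) :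
    ∑ i ∈ S.filter (fun i => a i ≤ u), w i * Real.exp (a i * s) ≤ Real.exp ((s - t) * u) * tiltZ S w a t := by
  calc ∑ i ∈ S.filter (fun i => a i ≤ u), w i * Real.exp (a i * s)
      ≤ ∑ i ∈ S.filter (fun i => a i ≤ u), Real.exp ((s - t) * u) * (w i * Real.exp (a i * t)) := by
        refine Finset.sum_le_sum fun i hi => ?_
        obtain ⟨hiS, hiu⟩ := Finset.mem_filter.1 hi
        have hexp : Real.exp (a i * s) ≤ Real.exp ((s - t) * u) * Real.exp (a i * t) := by
          rw [← Real.exp_add, Real.exp_le_exp]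
          have := mul_le_mul_of_nonneg_left hiu (sub_nonneg.2 hts)
          linarith
        calc w i * Real.exp (a i * s) ≤ w i * (Real.exp ((s - t) * u) * Real.exp (a i * t)) :=
              mul_le_mul_of_nonneg_left hexp (hw i hiS)
          _ = Real.exp ((s - t) * u) * (w i * Real.exp (a i * t)) := by ring
    _ = Real.exp ((s - t) * u) * ∑ i ∈ S.filter (fun i => a i ≤ u), w i * Real.exp (a i * t) := by
        rw [Finset.mul_sum]
    _ ≤ Real.exp ((s - t) * u) * tiltZ S w a t := by
        refine mul_le_mul_of_nonneg_left ?_ (Real.exp_pos _).le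
        exact Finset.sum_le_sum_of_subset_of_nonneg (Finset.filter_subset _ S)
          fun i hi _ => mul_nonneg (hw i hi) (Real.exp_pos _).le

end ExpTilt

/-! ## §2 Pulled bridges: `Z^B_N(e^s)` is an exponential family in the force `s = log y` -/

namespace Zd

open ExpTilt

/-- **`E^{B,y}_N[span]`**, the mean span under Beaton's pulled-bridge law `P^{B,y}_N(ω) ∝ y^{span ω}` on `N`-step
bridges: `(Σ_A A·β_{N,A} y^A) / Z^B_N(y)`. [cite: Beaton2015, §2 (B(x,y))] -/
def pulledMeanSpan (d : ℕ) [NeZero d] (N : ℕ) (y : ℝ) : ℝ :=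
  (∑ A ∈ Finset.range (N + 1), ((brSpan d N (A : ℤ)).card : ℝ) * (A : ℝ) * y ^ A) / pulledBridgeZ d N y

/-- `Z^B_N(e^s) = Σ_A β_{N,A} e^{A s}`. [cite: Beaton2015, §2 (B(x,y))] -/
theorem pulledBridgeZ_exp_eq_tiltZ (d : ℕ) [NeZero d] (N : ℕ) (s : ℝ) :
    pulledBridgeZ d N (Real.exp s) =
      tiltZ (Finset.range (N + 1)) (fun A : ℕ => ((brSpan d N (A : ℤ)).card : ℝ)) (fun A : ℕ => (A : ℝ)) s := by
  simp only [pulledBridgeZ, tiltZ, ← Real.exp_nat_mul]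

/-- `E^{B,e^s}_N[span]` is the tilted mean of the span family. [cite: Beaton2015, §2 (B(x,y))] -/
theorem pulledMeanSpan_exp (d : ℕ) [NeZero d] (N : ℕ) (s : ℝ) :
    pulledMeanSpan d N (Real.exp s) =
      tiltMean (Finset.range (N + 1)) (fun A : ℕ => ((brSpan d N (A : ℤ)).card : ℝ)) (fun A : ℕ => (A : ℝ)) s := by
  rw [pulledMeanSpan, pulledBridgeZ_exp_eq_tiltZ]
  simp only [tiltMean, ← Real.exp_nat_mul]

/-- Positivity of the span family's partition sum (`= Z^B_N(e^s) > 0`). [cite: Beaton2015, §2] -/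
theorem tiltZ_brSpan_pos (d N : ℕ) (s : ℝ) :
    0 < tiltZ (Finset.range (N + 1)) (fun A : ℕ => ((brSpan (d + 1) N (A : ℤ)).card : ℝ)) (fun A : ℕ => (A : ℝ)) s := by
  rw [← pulledBridgeZ_exp_eq_tiltZ]
  exact pulledBridgeZ_pos d N (Real.exp_pos s)

/-- `0 ≤ E^{B,y}_N[span]`. [cite: Beaton2015, §2] -/
theorem pulledMeanSpan_nonneg (d N : ℕ) {y : ℝ} (hy : 0 ≤ y) : 0 ≤ pulledMeanSpan (d + 1) N y := by
  unfold pulledMeanSpan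
  exact div_nonneg (Finset.sum_nonneg fun A _ => by positivity) (pulledBridgeZ_nonneg N hy)

/-- `E^{B,y}_N[span] ≤ N`. [cite: Beaton2015, §2] -/
theorem pulledMeanSpan_le (d N : ℕ) {y : ℝ} (hy : 0 < y) : pulledMeanSpan (d + 1) N y ≤ N := by
  unfold pulledMeanSpan
  rw [div_le_iff₀ (pulledBridgeZ_pos d N hy), pulledBridgeZ, Finset.mul_sum]
  refine Finset.sum_le_sum fun A hA => ?_
  have hA' : (A : ℝ) ≤ N := by exact_mod_cast Nat.lt_succ_iff.1 (Finset.mem_range.1 hA)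
  have h0 : 0 ≤ ((brSpan (d + 1) N (A : ℤ)).card : ℝ) * y ^ A := by positivity
  calc ((brSpan (d + 1) N (A : ℤ)).card : ℝ) * A * y ^ A
      = A * (((brSpan (d + 1) N (A : ℤ)).card : ℝ) * y ^ A) := by ring
    _ ≤ N * (((brSpan (d + 1) N (A : ℤ)).card : ℝ) * y ^ A) := mul_le_mul_of_nonneg_right hA' h0

/-- **Supporting line for pulled bridges, force form**: `(t - s)·E^{B,e^s}_N[span] ≤ log Z^B_N(e^t) - log Z^B_N(e^s)`.
[cite: Beaton2015, §2 (B(x,y))] -/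
theorem mul_pulledMeanSpan_exp_le (d N : ℕ) (s t : ℝ) :
    (t - s) * pulledMeanSpan (d + 1) N (Real.exp s) ≤
      Real.log (pulledBridgeZ (d + 1) N (Real.exp t)) - Real.log (pulledBridgeZ (d + 1) N (Real.exp s)) := by
  rw [pulledMeanSpan_exp, pulledBridgeZ_exp_eq_tiltZ, pulledBridgeZ_exp_eq_tiltZ]
  exact mul_tiltMean_le_log_sub _ (fun _ _ => Nat.cast_nonneg _) _ (tiltZ_brSpan_pos d N) s t

/-- **Supporting line for pulled bridges**: `(log y' - log y)·E^{B,y}_N[span] ≤ log Z^B_N(y') - log Z^B_N(y)`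
(`y, y' > 0`). [cite: Beaton2015, §2 (B(x,y))] -/
theorem mul_pulledMeanSpan_le_log_sub (d N : ℕ) {y y' : ℝ} (hy : 0 < y) (hy' : 0 < y') :
    (Real.log y' - Real.log y) * pulledMeanSpan (d + 1) N y ≤
      Real.log (pulledBridgeZ (d + 1) N y') - Real.log (pulledBridgeZ (d + 1) N y) := by
  have h := mul_pulledMeanSpan_exp_le d N (Real.log y) (Real.log y')
  rwa [Real.exp_log hy, Real.exp_log hy'] at h

/-- **`E^{B,y}_N[span]` is non-decreasing in `y`** on `(0, ∞)`. [cite: Beaton2015, §2 (B(x,y))] -/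
theorem pulledMeanSpan_mono (d N : ℕ) {y y' : ℝ} (hy : 0 < y) (hyy : y ≤ y') :
    pulledMeanSpan (d + 1) N y ≤ pulledMeanSpan (d + 1) N y' := by
  have hy' : 0 < y' := hy.trans_le hyy
  have h := tiltMean_mono _ (fun _ _ => Nat.cast_nonneg _) _ (tiltZ_brSpan_pos d N)
    (Real.log_le_log hy hyy)
  rwa [← pulledMeanSpan_exp, ← pulledMeanSpan_exp, Real.exp_log hy, Real.exp_log hy'] at h

/-- **Force–extension monotonicity (adjacent secants)**: for `0 < y₁ < y₂ < y₃`,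
`(λ_B(y₂) - λ_B(y₁))/(log y₂ - log y₁) ≤ (λ_B(y₃) - λ_B(y₂))/(log y₃ - log y₂)`. [cite: Beaton2015, §2 (λ(y))] -/
theorem pulledBridgeFreeEnergy_secant_mono (d : ℕ) {y₁ y₂ y₃ : ℝ} (h₁ : 0 < y₁) (h₁₂ : y₁ < y₂) (h₂₃ : y₂ < y₃) :
    (pulledBridgeFreeEnergy (d + 1) y₂ - pulledBridgeFreeEnergy (d + 1) y₁) / (Real.log y₂ - Real.log y₁) ≤
      (pulledBridgeFreeEnergy (d + 1) y₃ - pulledBridgeFreeEnergy (d + 1) y₂) / (Real.log y₃ - Real.log y₂) := by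
  have h₂ : 0 < y₂ := h₁.trans h₁₂
  have h₃ : 0 < y₃ := h₂.trans h₂₃
  have h := (pulledBridgeFreeEnergy_exp_convexOn d).slope_mono_adjacent (Set.mem_univ (Real.log y₁))
    (Set.mem_univ (Real.log y₃)) (Real.log_lt_log h₁ h₁₂) (Real.log_lt_log h₂ h₂₃)
  simpa only [Real.exp_log h₁, Real.exp_log h₂, Real.exp_log h₃] using h

/-- **Secants from a fixed left end-point are non-decreasing**: for `0 < x < y < z`,
`(λ_B(y) - λ_B(x))/(log y - log x) ≤ (λ_B(z) - λ_B(x))/(log z - log x)`. [cite: Beaton2015, §2 (λ(y))] -/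
theorem pulledBridgeFreeEnergy_secant_mono_left (d : ℕ) {x y z : ℝ} (hx : 0 < x) (hxy : x < y) (hyz : y < z) :
    (pulledBridgeFreeEnergy (d + 1) y - pulledBridgeFreeEnergy (d + 1) x) / (Real.log y - Real.log x) ≤
      (pulledBridgeFreeEnergy (d + 1) z - pulledBridgeFreeEnergy (d + 1) x) / (Real.log z - Real.log x) := by
  have hy : 0 < y := hx.trans hxy
  have hz : 0 < z := hy.trans hyz
  have h := (pulledBridgeFreeEnergy_exp_convexOn d).secant_mono_aux2 (Set.mem_univ (Real.log x))
    (Set.mem_univ (Real.log z)) (Real.log_lt_log hx hxy) (Real.log_lt_log hy hyz)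
  simpa only [Real.exp_log hx, Real.exp_log hy, Real.exp_log hz] using h

/-- `Z^B_N(y') ≤ (y'/y)^N Z^B_N(y)` for `0 < y ≤ y'` (the span is at most `N`). [cite: Beaton2015, §2 (B(x,y))] -/
theorem pulledBridgeZ_le_pow_mul (d N : ℕ) {y y' : ℝ} (hy : 0 < y) (hyy : y ≤ y') :
    pulledBridgeZ (d + 1) N y' ≤ (y' / y) ^ N * pulledBridgeZ (d + 1) N y := by
  simp only [pulledBridgeZ]
  rw [Finset.mul_sum]
  refine Finset.sum_le_sum fun A hA => ?_
  have hAN : A ≤ N := Nat.lt_succ_iff.1 (Finset.mem_range.1 hA)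
  have hr : 1 ≤ y' / y := by rwa [le_div_iff₀ hy, one_mul]
  have hc : (0 : ℝ) ≤ ((brSpan (d + 1) N (A : ℤ)).card : ℝ) := Nat.cast_nonneg _
  calc ((brSpan (d + 1) N (A : ℤ)).card : ℝ) * y' ^ A
      = ((brSpan (d + 1) N (A : ℤ)).card : ℝ) * ((y' / y) ^ A * y ^ A) := by
        rw [← mul_pow, div_mul_cancel₀ _ hy.ne']
    _ ≤ ((brSpan (d + 1) N (A : ℤ)).card : ℝ) * ((y' / y) ^ N * y ^ A) := by
        refine mul_le_mul_of_nonneg_left ?_ hc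
        exact mul_le_mul_of_nonneg_right (pow_le_pow_right₀ hr hAN) (pow_nonneg hy.le A)
    _ = (y' / y) ^ N * (((brSpan (d + 1) N (A : ℤ)).card : ℝ) * y ^ A) := by ring

/-- **The extension per step is at most one**: `λ_B(y') - λ_B(y) ≤ log y' - log y` for `0 < y ≤ y'`.
[cite: Beaton2015, §2 (λ(y))] -/
theorem pulledBridgeFreeEnergy_sub_le_log_sub (d : ℕ) {y y' : ℝ} (hy : 0 < y) (hyy : y ≤ y') :
    pulledBridgeFreeEnergy (d + 1) y' - pulledBridgeFreeEnergy (d + 1) y ≤ Real.log y' - Real.log y := by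
  have hy' : 0 < y' := hy.trans_le hyy
  have hr : 0 < y' / y := div_pos hy' hy
  have hf := tendsto_pulledBridgeFreeEnergy d hy'
  have hg : Tendsto (fun N : ℕ => Real.log (y' / y) + Real.log (pulledBridgeZ (d + 1) N y) / N) atTop
      (𝓝 (Real.log (y' / y) + pulledBridgeFreeEnergy (d + 1) y)) :=
    tendsto_const_nhds.add (tendsto_pulledBridgeFreeEnergy d hy)
  have hpt : ∀ N : ℕ, 1 ≤ N → Real.log (pulledBridgeZ (d + 1) N y') / N ≤
      Real.log (y' / y) + Real.log (pulledBridgeZ (d + 1) N y) / N := by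
    intro N hN
    have hN0 : (0 : ℝ) < N := by exact_mod_cast hN
    have h1 := Real.log_le_log (pulledBridgeZ_pos d N hy') (pulledBridgeZ_le_pow_mul d N hy hyy)
    rw [Real.log_mul (pow_pos hr N).ne' (pulledBridgeZ_pos d N hy).ne', Real.log_pow] at h1
    rw [div_le_iff₀ hN0, add_mul, div_mul_cancel₀ _ hN0.ne']
    linarith
  have hle := le_of_tendsto_of_tendsto hf hg (Filter.eventually_atTop.2 ⟨1, hpt⟩)
  rw [Real.log_div hy'.ne' hy.ne'] at hle
  linarith

/-! ### Mean extension per step versus free-energy secants -/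

/-- **Finite-`N` upper bound**: for `N ≥ 1` and `0 < y < y'`,
`E^{B,y}_N[span]/N ≤ (λ_B(y') - N⁻¹ log Z^B_N(y)) / (log y' - log y)` (supporting line at `y`, then
`N⁻¹ log Z^B_N(y') ≤ λ_B(y')`). [cite: Beaton2015, §2 (B(x,y)), §3] -/
theorem pulledMeanSpan_div_le (d : ℕ) {N : ℕ} (hN : 1 ≤ N) {y y' : ℝ} (hy : 0 < y) (hyy : y < y') :
    pulledMeanSpan (d + 1) N y / N ≤
      (pulledBridgeFreeEnergy (d + 1) y' - Real.log (pulledBridgeZ (d + 1) N y) / N) /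
        (Real.log y' - Real.log y) := by
  have hy' : 0 < y' := hy.trans hyy
  have hN0 : (0 : ℝ) < N := by exact_mod_cast hN
  have hlog : 0 < Real.log y' - Real.log y := sub_pos.2 (Real.log_lt_log hy hyy)
  have h1 := mul_pulledMeanSpan_le_log_sub d N hy hy'
  have h2 := log_div_le_pulledBridgeFreeEnergy d hy' hN
  have h3 : Real.log (pulledBridgeZ (d + 1) N y') ≤ pulledBridgeFreeEnergy (d + 1) y' * N := by
    rwa [div_le_iff₀ hN0] at h2
  rw [le_div_iff₀ hlog, div_mul_eq_mul_div, div_le_iff₀ hN0, sub_mul, div_mul_cancel₀ _ hN0.ne']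
  linarith

/-- **Finite-`N` lower bound**: for `N ≥ 1` and `0 < y'' < y`,
`(N⁻¹ log Z^B_N(y) - λ_B(y'')) / (log y - log y'') ≤ E^{B,y}_N[span]/N`. [cite: Beaton2015, §2 (B(x,y)), §3] -/
theorem le_pulledMeanSpan_div (d : ℕ) {N : ℕ} (hN : 1 ≤ N) {y'' y : ℝ} (hy'' : 0 < y'') (hyy : y'' < y) :
    (Real.log (pulledBridgeZ (d + 1) N y) / N - pulledBridgeFreeEnergy (d + 1) y'') /
        (Real.log y - Real.log y'') ≤ pulledMeanSpan (d + 1) N y / N := by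
  have hy : 0 < y := hy''.trans hyy
  have hN0 : (0 : ℝ) < N := by exact_mod_cast hN
  have hlog : 0 < Real.log y - Real.log y'' := sub_pos.2 (Real.log_lt_log hy'' hyy)
  have h1 := mul_pulledMeanSpan_le_log_sub d N hy hy''
  have h2 := log_div_le_pulledBridgeFreeEnergy d hy'' hN
  have h3 : Real.log (pulledBridgeZ (d + 1) N y'') ≤ pulledBridgeFreeEnergy (d + 1) y'' * N := by
    rwa [div_le_iff₀ hN0] at h2
  rw [div_le_iff₀ hlog, div_mul_eq_mul_div, le_div_iff₀ hN0, sub_mul, div_mul_cancel₀ _ hN0.ne']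
  linarith

/-- **Asymptotic upper bound for the mean extension per step**: for `0 < y < y'` and `ε > 0`, eventually in `N`,
`E^{B,y}_N[span]/N ≤ (λ_B(y') - λ_B(y))/(log y' - log y) + ε`. [cite: Beaton2015, §2 (λ(y)), §3] -/
theorem eventually_pulledMeanSpan_div_le (d : ℕ) {y y' : ℝ} (hy : 0 < y) (hyy : y < y') {ε : ℝ} (hε : 0 < ε) :
    ∀ᶠ N : ℕ in atTop, pulledMeanSpan (d + 1) N y / N ≤
      (pulledBridgeFreeEnergy (d + 1) y' - pulledBridgeFreeEnergy (d + 1) y) / (Real.log y' - Real.log y) + ε := by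
  have ht := tendsto_pulledBridgeFreeEnergy d hy
  have ht' : Tendsto (fun N : ℕ => (pulledBridgeFreeEnergy (d + 1) y' -
      Real.log (pulledBridgeZ (d + 1) N y) / N) / (Real.log y' - Real.log y)) atTop
      (𝓝 ((pulledBridgeFreeEnergy (d + 1) y' - pulledBridgeFreeEnergy (d + 1) y) / (Real.log y' - Real.log y))) :=
    (tendsto_const_nhds.sub ht).div_const _
  filter_upwards [ht'.eventually_lt_const (lt_add_of_pos_right _ hε), eventually_ge_atTop 1] with N hN hN1
  exact (pulledMeanSpan_div_le d hN1 hy hyy).trans hN.le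

/-- **Asymptotic lower bound for the mean extension per step**: for `0 < y'' < y` and `ε > 0`, eventually in `N`,
`(λ_B(y) - λ_B(y''))/(log y - log y'') - ε ≤ E^{B,y}_N[span]/N`. [cite: Beaton2015, §2 (λ(y)), §3] -/
theorem eventually_le_pulledMeanSpan_div (d : ℕ) {y'' y : ℝ} (hy'' : 0 < y'') (hyy : y'' < y) {ε : ℝ} (hε : 0 < ε) :
    ∀ᶠ N : ℕ in atTop, (pulledBridgeFreeEnergy (d + 1) y - pulledBridgeFreeEnergy (d + 1) y'') /
        (Real.log y - Real.log y'') - ε ≤ pulledMeanSpan (d + 1) N y / N := by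
  have hy : 0 < y := hy''.trans hyy
  have ht := tendsto_pulledBridgeFreeEnergy d hy
  have ht' : Tendsto (fun N : ℕ => (Real.log (pulledBridgeZ (d + 1) N y) / N -
      pulledBridgeFreeEnergy (d + 1) y'') / (Real.log y - Real.log y'')) atTop
      (𝓝 ((pulledBridgeFreeEnergy (d + 1) y - pulledBridgeFreeEnergy (d + 1) y'') / (Real.log y - Real.log y''))) :=
    (ht.sub tendsto_const_nhds).div_const _
  filter_upwards [ht'.eventually_const_lt (sub_lt_self _ hε), eventually_ge_atTop 1] with N hN hN1
  exact hN.le.trans (le_pulledMeanSpan_div d hN1 hy'' hyy)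

/-! ### From free-energy windows to secant (extension) windows -/

/-- Certificate reading, lower side: `(y₀/x)^p ≤ (L₀/Uₓ)^q` ⇒ `p (log y₀ - log x) ≤ q (log L₀ - log Uₓ)`. [cite: Beaton2015, §2] -/
theorem log_cert_lower {x y₀ L₀ Ux : ℝ} (p q : ℕ) (hx : 0 < x) (hy₀ : 0 < y₀) (hL : 0 < L₀) (hU : 0 < Ux)
    (hcert : (y₀ / x) ^ p ≤ (L₀ / Ux) ^ q) :
    (p : ℝ) * (Real.log y₀ - Real.log x) ≤ (q : ℝ) * (Real.log L₀ - Real.log Ux) := by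
  have h := Real.log_le_log (by positivity) hcert
  rwa [Real.log_pow, Real.log_pow, Real.log_div hy₀.ne' hx.ne', Real.log_div hL.ne' hU.ne'] at h

/-- Certificate reading, upper side: `(U_z/L₀)^q ≤ (z/y₀)^p` ⇒ `q (log U_z - log L₀) ≤ p (log z - log y₀)`. [cite: Beaton2015, §2] -/
theorem log_cert_upper {y₀ z L₀ Uz : ℝ} (p q : ℕ) (hy₀ : 0 < y₀) (hz : 0 < z) (hL : 0 < L₀) (hU : 0 < Uz)
    (hcert : (Uz / L₀) ^ q ≤ (z / y₀) ^ p) :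
    (q : ℝ) * (Real.log Uz - Real.log L₀) ≤ (p : ℝ) * (Real.log z - Real.log y₀) := by
  have h := Real.log_le_log (by positivity) hcert
  rwa [Real.log_pow, Real.log_pow, Real.log_div hU.ne' hL.ne', Real.log_div hz.ne' hy₀.ne'] at h

/-- **A window secant from below**: if `log L₀ ≤ λ_B(y₀)`, `λ_B(x) ≤ log Uₓ` (`0 < x < y₀`) and
`p (log y₀ - log x) ≤ q (log L₀ - log Uₓ)` (`q > 0`), then `p/q ≤ (λ_B(y₀) - λ_B(x))/(log y₀ - log x)`.
[cite: Beaton2015, §2 (λ(y))] -/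
theorem secant_ge_of_window (d : ℕ) {x y₀ L₀ Ux p q : ℝ} (hx : 0 < x) (hlt : x < y₀) (hq : 0 < q)
    (hL : Real.log L₀ ≤ pulledBridgeFreeEnergy (d + 1) y₀) (hU : pulledBridgeFreeEnergy (d + 1) x ≤ Real.log Ux)
    (hcert : p * (Real.log y₀ - Real.log x) ≤ q * (Real.log L₀ - Real.log Ux)) :
    p / q ≤ (pulledBridgeFreeEnergy (d + 1) y₀ - pulledBridgeFreeEnergy (d + 1) x) / (Real.log y₀ - Real.log x) := by
  have hlog : 0 < Real.log y₀ - Real.log x := sub_pos.2 (Real.log_lt_log hx hlt)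
  have hwin : Real.log L₀ - Real.log Ux ≤ pulledBridgeFreeEnergy (d + 1) y₀ - pulledBridgeFreeEnergy (d + 1) x := by
    linarith
  have := mul_le_mul_of_nonneg_left hwin hq.le
  rw [div_le_iff₀ hq, div_mul_eq_mul_div, le_div_iff₀ hlog]
  linarith

/-- **A window secant from above**: if `log L₀ ≤ λ_B(y₀)`, `λ_B(z) ≤ log U_z` (`0 < y₀ < z`) and
`q (log U_z - log L₀) ≤ p (log z - log y₀)` (`q > 0`), then `(λ_B(z) - λ_B(y₀))/(log z - log y₀) ≤ p/q`.
[cite: Beaton2015, §2 (λ(y))] -/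
theorem secant_le_of_window (d : ℕ) {y₀ z L₀ Uz p q : ℝ} (hy₀ : 0 < y₀) (hlt : y₀ < z) (hq : 0 < q)
    (hL : Real.log L₀ ≤ pulledBridgeFreeEnergy (d + 1) y₀) (hU : pulledBridgeFreeEnergy (d + 1) z ≤ Real.log Uz)
    (hcert : q * (Real.log Uz - Real.log L₀) ≤ p * (Real.log z - Real.log y₀)) :
    (pulledBridgeFreeEnergy (d + 1) z - pulledBridgeFreeEnergy (d + 1) y₀) / (Real.log z - Real.log y₀) ≤ p / q := by
  have hlog : 0 < Real.log z - Real.log y₀ := sub_pos.2 (Real.log_lt_log hy₀ hlt)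
  have hwin : pulledBridgeFreeEnergy (d + 1) z - pulledBridgeFreeEnergy (d + 1) y₀ ≤ Real.log Uz - Real.log L₀ := by
    linarith
  have := mul_le_mul_of_nonneg_left hwin hq.le
  rw [le_div_iff₀ hq, div_mul_eq_mul_div, div_le_iff₀ hlog]
  linarith

/-- **Right secants from a left window**: under the hypotheses of `secant_ge_of_window`, every secant of the free
energy starting at `y₀` (to the right) has slope `≥ p/q`; in particular the right-derivative of `s ↦ λ_B(e^s)` at
`log y₀` — the asymptotic extension per step at force `log y₀⁺` — is `≥ p/q`. [cite: Beaton2015, §2 (λ(y))] -/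
theorem rightSecant_ge_of_window (d : ℕ) {x y₀ L₀ Ux p q : ℝ} (hx : 0 < x) (hlt : x < y₀) (hq : 0 < q)
    (hL : Real.log L₀ ≤ pulledBridgeFreeEnergy (d + 1) y₀) (hU : pulledBridgeFreeEnergy (d + 1) x ≤ Real.log Ux)
    (hcert : p * (Real.log y₀ - Real.log x) ≤ q * (Real.log L₀ - Real.log Ux)) {y : ℝ} (hy : y₀ < y) :
    p / q ≤ (pulledBridgeFreeEnergy (d + 1) y - pulledBridgeFreeEnergy (d + 1) y₀) / (Real.log y - Real.log y₀) :=
  (secant_ge_of_window d hx hlt hq hL hU hcert).trans (pulledBridgeFreeEnergy_secant_mono d hx hlt hy)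

/-- **Left secants from a right window**: under the hypotheses of `secant_le_of_window`, every secant of the free
energy ending at `y₀` (from the left) has slope `≤ p/q`; in particular the left-derivative at `log y₀` is `≤ p/q`.
[cite: Beaton2015, §2 (λ(y))] -/
theorem leftSecant_le_of_window (d : ℕ) {y₀ z L₀ Uz p q : ℝ} (hy₀ : 0 < y₀) (hlt : y₀ < z) (hq : 0 < q)
    (hL : Real.log L₀ ≤ pulledBridgeFreeEnergy (d + 1) y₀) (hU : pulledBridgeFreeEnergy (d + 1) z ≤ Real.log Uz)
    (hcert : q * (Real.log Uz - Real.log L₀) ≤ p * (Real.log z - Real.log y₀)) {y : ℝ} (hy0 : 0 < y)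
    (hy : y < y₀) :
    (pulledBridgeFreeEnergy (d + 1) y₀ - pulledBridgeFreeEnergy (d + 1) y) / (Real.log y₀ - Real.log y) ≤ p / q :=
  (pulledBridgeFreeEnergy_secant_mono d hy0 hy hlt).trans (secant_le_of_window d hy₀ hlt hq hL hU hcert)

/-- **Eventual mean-extension window from two secant bounds**: if the secant over `[x, y₀]` has slope `≥ lo` and
the secant over `[y₀, z]` has slope `≤ hi` (`0 < x < y₀ < z`), then for every `ε > 0`, eventually in `N`,
`lo - ε ≤ E^{B,y₀}_N[span]/N ≤ hi + ε`. [cite: Beaton2015, §2 (λ(y)), §3] -/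
theorem eventually_pulledMeanSpan_window (d : ℕ) {x y₀ z lo hi : ℝ} (hx : 0 < x) (hxy : x < y₀) (hyz : y₀ < z)
    (hlo : lo ≤ (pulledBridgeFreeEnergy (d + 1) y₀ - pulledBridgeFreeEnergy (d + 1) x) / (Real.log y₀ - Real.log x))
    (hhi : (pulledBridgeFreeEnergy (d + 1) z - pulledBridgeFreeEnergy (d + 1) y₀) / (Real.log z - Real.log y₀) ≤ hi)
    {ε : ℝ} (hε : 0 < ε) :
    ∀ᶠ N : ℕ in atTop, lo - ε ≤ pulledMeanSpan (d + 1) N y₀ / N ∧ pulledMeanSpan (d + 1) N y₀ / N ≤ hi + ε := by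
  have hy₀ : 0 < y₀ := hx.trans hxy
  filter_upwards [eventually_le_pulledMeanSpan_div d hx hxy hε, eventually_pulledMeanSpan_div_le d hy₀ hyz hε]
    with N h1 h2
  exact ⟨by linarith, by linarith⟩

/-! ## §3 Zero force: `λ_B ≥ log μ` on `[1, ∞)`, the zero-force slope, and bridge (non-)ballisticity -/

/-- `log μ ≤ λ_B(y)` for `y ≥ 1` (`λ_B(1) = log μ` and monotonicity). [cite: Beaton2015, §2, eq. (2)–(3)] -/
theorem log_connectiveConstant_le_pulledBridgeFreeEnergy (d : ℕ) {y : ℝ} (hy : 1 ≤ y) :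
    Real.log (connectiveConstant (d + 1)) ≤ pulledBridgeFreeEnergy (d + 1) y := by
  rw [← pulledBridgeFreeEnergy_one d]
  exact pulledBridgeFreeEnergy_mono d one_pos hy

/-- **Zero-force secants are non-decreasing**: `(λ_B(y) - log μ)/log y ≤ (λ_B(y') - log μ)/log y'` for
`1 < y < y'`; their infimum is the right-derivative of the free energy at zero force. [cite: Beaton2015, §2 (λ(y))] -/
theorem zeroForce_secant_mono (d : ℕ) {y y' : ℝ} (hy : 1 < y) (hyy : y < y') :
    (pulledBridgeFreeEnergy (d + 1) y - Real.log (connectiveConstant (d + 1))) / Real.log y ≤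
      (pulledBridgeFreeEnergy (d + 1) y' - Real.log (connectiveConstant (d + 1))) / Real.log y' := by
  have h := pulledBridgeFreeEnergy_secant_mono_left d one_pos hy hyy
  simpa only [Real.log_one, sub_zero, pulledBridgeFreeEnergy_one] using h

/-- Transfer of an EVENTUAL geometric upper bound: `Z^B_N(y) ≤ C K^N` for all large `N` ⇒ `λ_B(y) ≤ log K`.
[cite: MadrasSlade1993, Lemma 1.2.2 (Fekete); Beaton2015, §3] -/
theorem pulledBridgeFreeEnergy_le_log_of_eventually_geometric (d : ℕ) {y C K : ℝ} (hy : 0 < y) (hC : 0 < C)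
    (hK : 0 < K) (h : ∀ᶠ N : ℕ in atTop, pulledBridgeZ (d + 1) N y ≤ C * K ^ N) :
    pulledBridgeFreeEnergy (d + 1) y ≤ Real.log K := by
  have ht := tendsto_pulledBridgeFreeEnergy d hy
  have hupp : Tendsto (fun N : ℕ => Real.log C / N + Real.log K) atTop (𝓝 (0 + Real.log K)) :=
    (tendsto_const_div_atTop_nhds_zero_nat (Real.log C)).add tendsto_const_nhds
  rw [zero_add] at hupp
  refine le_of_tendsto_of_tendsto ht hupp ?_
  filter_upwards [h, eventually_ge_atTop 1] with N hN hN1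
  have hN0 : (0 : ℝ) < N := by exact_mod_cast hN1
  have hlog := Real.log_le_log (pulledBridgeZ_pos d N hy) hN
  rw [Real.log_mul hC.ne' (pow_pos hK N).ne', Real.log_pow] at hlog
  rw [div_add' _ _ _ hN0.ne', div_le_div_iff_of_pos_right hN0]
  linarith

/-- **Non-ballistic bridges keep the pulled partition function at zero-force size**: under DC–H's theorem, for every
`v > 0` there is `c > 0` such that for `0 ≤ s ≤ c` and all large `n`, `Z^B_n(e^s) ≤ 2 (μ e^{v s})^n`
(split the bridge sum at `span = v n`: below, the weight is `≤ e^{s v n}`; above, DC–H's count `≤ e^{-cn} b_n` beats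
the weight `e^{s n}`). The EXPONENTIAL rate `e^{-cn}` of the named fact (the tree's form, = DC–H §2.4 with Thm 2.5) is
used essentially: a rate-free "fraction `→ 0`" would not control the `e^{s n}` tail term (a-ref-1 g17, note 1).
[cite: DuminilCopinHammond2013, §2.4] -/
theorem pulledBridgeZ_exp_le_of_bridgeNotBallistic (h : DuminilCopinHammond2013_bridgeNotBallistic) (d : ℕ)
    (hd : 1 ≤ d) {v : ℝ} (hv : 0 < v) :
    ∃ c : ℝ, 0 < c ∧ ∀ s : ℝ, 0 ≤ s → s ≤ c → ∀ᶠ n : ℕ in atTop,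
      pulledBridgeZ (d + 1) n (Real.exp s) ≤ 2 * (connectiveConstant (d + 1) * Real.exp (v * s)) ^ n := by
  obtain ⟨c, hc, n₀, hn₀⟩ := h (d + 1) (by omega) v hv
  refine ⟨c, hc, fun s hs0 hsc => ?_⟩
  filter_upwards [eventually_ge_atTop n₀] with n hn
  have hμ := connectiveConstant_pos (d + 1)
  have hb : (bridgeCount (d + 1) n : ℝ) ≤ connectiveConstant (d + 1) ^ n := bridgeCount_le_pow n
  have hes : 1 ≤ Real.exp s := Real.one_le_exp hs0
  have hevs : 1 ≤ Real.exp (v * s) := Real.one_le_exp (by positivity)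
  have hKn : connectiveConstant (d + 1) ^ n ≤ (connectiveConstant (d + 1) * Real.exp (v * s)) ^ n := by
    rw [mul_pow]
    exact le_mul_of_one_le_right (pow_nonneg hμ.le n) (one_le_pow₀ hevs)
  rw [pulledBridgeZ_eq_sum_bridges, ← Finset.sum_filter_add_sum_filter_not (bridges (d + 1) n)
    (fun ω => v * (n : ℝ) ≤ ((ω n 0 : ℤ) : ℝ))]
  have hHi : ∑ ω ∈ (bridges (d + 1) n).filter (fun ω => v * (n : ℝ) ≤ ((ω n 0 : ℤ) : ℝ)),
      Real.exp s ^ (ω n 0).toNat ≤ (connectiveConstant (d + 1) * Real.exp (v * s)) ^ n := by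
    calc ∑ ω ∈ (bridges (d + 1) n).filter (fun ω => v * (n : ℝ) ≤ ((ω n 0 : ℤ) : ℝ)), Real.exp s ^ (ω n 0).toNat
        ≤ ∑ ω ∈ (bridges (d + 1) n).filter (fun ω => v * (n : ℝ) ≤ ((ω n 0 : ℤ) : ℝ)), Real.exp s ^ n := by
          refine Finset.sum_le_sum fun ω hω => ?_
          have hωB := (Finset.mem_filter.1 hω).1
          have hsp : (ω n 0).toNat ≤ n := by
            have := span_le_of_mem_bridges' hωB
            omega
          exact pow_le_pow_right₀ hes hsp
      _ = (((bridges (d + 1) n).filter (fun ω => v * (n : ℝ) ≤ ((ω n 0 : ℤ) : ℝ))).card : ℝ) * Real.exp s ^ n := by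
          rw [Finset.sum_const, nsmul_eq_mul]
      _ ≤ Real.exp (-(c * n)) * (bridgeCount (d + 1) n : ℝ) * Real.exp s ^ n :=
          mul_le_mul_of_nonneg_right (hn₀ n hn) (pow_nonneg (Real.exp_pos s).le n)
      _ ≤ Real.exp (-(c * n)) * connectiveConstant (d + 1) ^ n * Real.exp s ^ n :=
          mul_le_mul_of_nonneg_right (mul_le_mul_of_nonneg_left hb (Real.exp_pos _).le)
            (pow_nonneg (Real.exp_pos s).le n)
      _ = connectiveConstant (d + 1) ^ n * Real.exp ((s - c) * n) := by
          rw [← Real.exp_nat_mul, show (s - c) * (n : ℝ) = -(c * n) + n * s by ring, Real.exp_add]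
          ring
      _ ≤ connectiveConstant (d + 1) ^ n * 1 := by
          refine mul_le_mul_of_nonneg_left ?_ (pow_nonneg hμ.le n)
          rw [Real.exp_le_one_iff]
          have : (s - c) * (n : ℝ) ≤ 0 := mul_nonpos_of_nonpos_of_nonneg (by linarith) (Nat.cast_nonneg n)
          exact this
      _ ≤ (connectiveConstant (d + 1) * Real.exp (v * s)) ^ n := by rw [mul_one]; exact hKn
  have hLo : ∑ ω ∈ (bridges (d + 1) n).filter (fun ω => ¬ (v * (n : ℝ) ≤ ((ω n 0 : ℤ) : ℝ))),
      Real.exp s ^ (ω n 0).toNat ≤ (connectiveConstant (d + 1) * Real.exp (v * s)) ^ n := by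
    calc ∑ ω ∈ (bridges (d + 1) n).filter (fun ω => ¬ (v * (n : ℝ) ≤ ((ω n 0 : ℤ) : ℝ))),
          Real.exp s ^ (ω n 0).toNat
        ≤ ∑ ω ∈ (bridges (d + 1) n).filter (fun ω => ¬ (v * (n : ℝ) ≤ ((ω n 0 : ℤ) : ℝ))),
            Real.exp (v * s) ^ n := by
          refine Finset.sum_le_sum fun ω hω => ?_
          obtain ⟨hωB, hlt⟩ := Finset.mem_filter.1 hω
          rw [not_le] at hlt
          have h0 := span_nonneg_of_mem_bridges' hωB
          have hk : (((ω n 0).toNat : ℕ) : ℝ) = ((ω n 0 : ℤ) : ℝ) := by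
            have h1 : (((ω n 0).toNat : ℕ) : ℤ) = ω n 0 := Int.toNat_of_nonneg h0
            exact_mod_cast h1
          rw [← Real.exp_nat_mul, ← Real.exp_nat_mul, Real.exp_le_exp, hk]
          have := mul_le_mul_of_nonneg_right hlt.le hs0
          linarith
      _ = (((bridges (d + 1) n).filter (fun ω => ¬ (v * (n : ℝ) ≤ ((ω n 0 : ℤ) : ℝ)))).card : ℝ) *
            Real.exp (v * s) ^ n := by
          rw [Finset.sum_const, nsmul_eq_mul]
      _ ≤ (bridgeCount (d + 1) n : ℝ) * Real.exp (v * s) ^ n := by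
          refine mul_le_mul_of_nonneg_right ?_ (pow_nonneg (Real.exp_pos _).le n)
          have hcard : ((bridges (d + 1) n).filter (fun ω => ¬ (v * (n : ℝ) ≤ ((ω n 0 : ℤ) : ℝ)))).card ≤
              bridgeCount (d + 1) n := Finset.card_filter_le _ _
          exact_mod_cast hcard
      _ ≤ connectiveConstant (d + 1) ^ n * Real.exp (v * s) ^ n :=
          mul_le_mul_of_nonneg_right hb (pow_nonneg (Real.exp_pos _).le n)
      _ = (connectiveConstant (d + 1) * Real.exp (v * s)) ^ n := by rw [mul_pow]
  have := add_le_add hHi hLo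
  linarith

/-- **DC–H ⇒ the zero-force slope of the pulled-bridge free energy vanishes**: for every `v > 0` there is `s₀ > 0`
with `λ_B(e^s) ≤ log μ + v·s` for all `0 ≤ s ≤ s₀` (every `ℤ^{d+1}`, `d + 1 ≥ 2`). With
`log μ ≤ λ_B(e^s)` (`log_connectiveConstant_le_pulledBridgeFreeEnergy`) this says: the right-derivative of the free
energy at zero force is `0` — Beaton's pulling transition at `y_c = 1` has no extension jump.
[cite: DuminilCopinHammond2013, §2.4; Beaton2015, Theorem 1] -/
theorem pulledBridgeFreeEnergy_exp_le_of_bridgeNotBallistic (h : DuminilCopinHammond2013_bridgeNotBallistic)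
    (d : ℕ) (hd : 1 ≤ d) {v : ℝ} (hv : 0 < v) :
    ∃ s₀ : ℝ, 0 < s₀ ∧ ∀ s : ℝ, 0 ≤ s → s ≤ s₀ →
      pulledBridgeFreeEnergy (d + 1) (Real.exp s) ≤ Real.log (connectiveConstant (d + 1)) + v * s := by
  obtain ⟨c, hc, hev⟩ := pulledBridgeZ_exp_le_of_bridgeNotBallistic h d hd hv
  refine ⟨c, hc, fun s hs0 hsc => ?_⟩
  have hμ := connectiveConstant_pos (d + 1)
  have hK : 0 < connectiveConstant (d + 1) * Real.exp (v * s) := mul_pos hμ (Real.exp_pos _)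
  have hle := pulledBridgeFreeEnergy_le_log_of_eventually_geometric d (Real.exp_pos s) two_pos hK (hev s hs0 hsc)
  rwa [Real.log_mul hμ.ne' (Real.exp_pos _).ne', Real.log_exp] at hle

/-- **The zero-force slope window under DC–H**: for every `v > 0` there is `s₀ > 0` such that for `0 < s ≤ s₀`
the zero-force secant `(λ_B(e^s) - log μ)/s` lies in `[0, v]`. [cite: DuminilCopinHammond2013, §2.4; Beaton2015, Theorem 1] -/
theorem zeroForce_secant_window_of_bridgeNotBallistic (h : DuminilCopinHammond2013_bridgeNotBallistic)
    (d : ℕ) (hd : 1 ≤ d) {v : ℝ} (hv : 0 < v) :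
    ∃ s₀ : ℝ, 0 < s₀ ∧ ∀ s : ℝ, 0 < s → s ≤ s₀ →
      0 ≤ (pulledBridgeFreeEnergy (d + 1) (Real.exp s) - Real.log (connectiveConstant (d + 1))) / s ∧
        (pulledBridgeFreeEnergy (d + 1) (Real.exp s) - Real.log (connectiveConstant (d + 1))) / s ≤ v := by
  obtain ⟨s₀, hs₀, hle⟩ := pulledBridgeFreeEnergy_exp_le_of_bridgeNotBallistic h d hd hv
  refine ⟨s₀, hs₀, fun s hs hss => ⟨?_, ?_⟩⟩
  · exact div_nonneg (sub_nonneg.2 (log_connectiveConstant_le_pulledBridgeFreeEnergy d (Real.one_le_exp hs.le))) hs.le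
  · rw [div_le_iff₀ hs]
    have := hle s hs.le hss
    linarith

/-- **Span tails are controlled by the free energy**: for `v, s ≥ 0` and `n ≥ 1`,
`#{ω ∈ B_n : span ω ≥ v n} ≤ exp(n (λ_B(e^s) - v s))` (Chernoff: `#{…}·e^{s v n} ≤ Z^B_n(e^s) ≤ e^{n λ_B(e^s)}`,
the last step being `λ_B = sup_N N⁻¹ log Z^B_N`). [cite: Beaton2015, §2–§3] -/
theorem bridge_span_tail_le_exp (d : ℕ) (v : ℝ) {s : ℝ} (hs : 0 ≤ s) {n : ℕ} (hn : 1 ≤ n) :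
    ((((bridges (d + 1) n).filter fun ω => v * (n : ℝ) ≤ ((ω n 0 : ℤ) : ℝ)).card : ℝ)) ≤
      Real.exp (n * (pulledBridgeFreeEnergy (d + 1) (Real.exp s) - v * s)) := by
  have hn0 : (0 : ℝ) < n := by exact_mod_cast hn
  have hZ := pulledBridgeZ_pos d n (Real.exp_pos s)
  -- `#Hi · e^{s v n} ≤ Z^B_n(e^s)`
  have h1 : ((((bridges (d + 1) n).filter fun ω => v * (n : ℝ) ≤ ((ω n 0 : ℤ) : ℝ)).card : ℝ)) *
      Real.exp (v * s) ^ n ≤ pulledBridgeZ (d + 1) n (Real.exp s) := by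
    rw [pulledBridgeZ_eq_sum_bridges]
    calc ((((bridges (d + 1) n).filter fun ω => v * (n : ℝ) ≤ ((ω n 0 : ℤ) : ℝ)).card : ℝ)) * Real.exp (v * s) ^ n
        = ∑ ω ∈ (bridges (d + 1) n).filter (fun ω => v * (n : ℝ) ≤ ((ω n 0 : ℤ) : ℝ)), Real.exp (v * s) ^ n := by
          rw [Finset.sum_const, nsmul_eq_mul]
      _ ≤ ∑ ω ∈ (bridges (d + 1) n).filter (fun ω => v * (n : ℝ) ≤ ((ω n 0 : ℤ) : ℝ)), Real.exp s ^ (ω n 0).toNat := by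
          refine Finset.sum_le_sum fun ω hω => ?_
          obtain ⟨hωB, hge⟩ := Finset.mem_filter.1 hω
          have h0 := span_nonneg_of_mem_bridges' hωB
          have hk : (((ω n 0).toNat : ℕ) : ℝ) = ((ω n 0 : ℤ) : ℝ) := by
            have h1 : (((ω n 0).toNat : ℕ) : ℤ) = ω n 0 := Int.toNat_of_nonneg h0
            exact_mod_cast h1
          rw [← Real.exp_nat_mul, ← Real.exp_nat_mul, Real.exp_le_exp, hk]
          have := mul_le_mul_of_nonneg_right hge hs
          linarith
      _ ≤ ∑ ω ∈ bridges (d + 1) n, Real.exp s ^ (ω n 0).toNat :=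
          Finset.sum_le_sum_of_subset_of_nonneg (Finset.filter_subset _ _)
            fun ω _ _ => pow_nonneg (Real.exp_pos s).le _
  -- `Z^B_n(e^s) ≤ e^{n λ_B(e^s)}`
  have h2 : pulledBridgeZ (d + 1) n (Real.exp s) ≤ Real.exp (n * pulledBridgeFreeEnergy (d + 1) (Real.exp s)) := by
    have h := log_div_le_pulledBridgeFreeEnergy d (Real.exp_pos s) hn
    rw [div_le_iff₀ hn0] at h
    calc pulledBridgeZ (d + 1) n (Real.exp s) = Real.exp (Real.log (pulledBridgeZ (d + 1) n (Real.exp s))) :=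
          (Real.exp_log hZ).symm
      _ ≤ Real.exp (n * pulledBridgeFreeEnergy (d + 1) (Real.exp s)) := by
          rw [Real.exp_le_exp]; linarith
  have hpow : 0 < Real.exp (v * s) ^ n := pow_pos (Real.exp_pos _) n
  rw [← le_div_iff₀ hpow] at h1
  refine h1.trans ?_
  rw [div_le_iff₀ hpow, ← Real.exp_nat_mul, ← Real.exp_add]
  refine h2.trans ?_
  rw [Real.exp_le_exp]
  nlinarith

/-- **Converse: a vanishing zero-force slope forces non-ballistic bridges.**  If for some force `s > 0` the free
energy satisfies `λ_B(e^s) < log μ + v s`, then `#{ω ∈ B_n : span ω ≥ v n} ≤ e^{-δ n} μ^n` for all `n ≥ 1` with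
`δ = log μ + v s - λ_B(e^s) > 0`; by Hammersley–Welsh (`e^{-C√n} μ^n ≤ b_n`) this is `≤ e^{-δ n/2} b_n` for large `n`.
Together with `pulledBridgeFreeEnergy_exp_le_of_bridgeNotBallistic`: DC–H's bridge non-ballisticity (exponential
form, all `v > 0`) is EQUIVALENT to `lim_{s↓0} (λ_B(e^s) - log μ)/s = 0`. [cite: DuminilCopinHammond2013, §2.4;
MadrasSlade1993, Corollary 3.1.6] -/
theorem bridge_span_tail_le_of_freeEnergy_lt (d : ℕ) {v s : ℝ} (hs : 0 ≤ s)
    (hlt : pulledBridgeFreeEnergy (d + 1) (Real.exp s) < Real.log (connectiveConstant (d + 1)) + v * s) :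
    ∃ δ : ℝ, 0 < δ ∧ ∀ n : ℕ, 1 ≤ n →
      ((((bridges (d + 1) n).filter fun ω => v * (n : ℝ) ≤ ((ω n 0 : ℤ) : ℝ)).card : ℝ)) ≤
        Real.exp (-(δ * n)) * connectiveConstant (d + 1) ^ n := by
  have hμ := connectiveConstant_pos (d + 1)
  refine ⟨Real.log (connectiveConstant (d + 1)) + v * s - pulledBridgeFreeEnergy (d + 1) (Real.exp s),
    sub_pos.2 hlt, fun n hn => ?_⟩
  refine (bridge_span_tail_le_exp d v hs hn).trans (le_of_eq ?_)
  rw [← Real.exp_log (pow_pos hμ n), ← Real.exp_add, Real.log_pow]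
  congr 1
  ring

/-- **Zero-force slope `0` ⇒ DC–H's statement (in dimension `d + 1`)**: if for every `v > 0` some force `s > 0` has
`λ_B(e^s) < log μ + v s`, then for every `v > 0` there are `c > 0`, `n₀` with `#{ω ∈ B_n : span ω ≥ v n} ≤ e^{-cn} b_n`
for `n ≥ n₀`. Here `log μ = λ_B(1)` (`Zd.pulledBridgeFreeEnergy_one`, the tree's normalisation `b_n^{1/n} → μ`), so the
hypothesis is literally "the right slope of the convex `s ↦ λ_B(e^s)` at `s = 0` is `0`"; Hammersley–Welsh
(`exp_mul_pow_le_bridgeCount`) converts `μ^n` into `b_n`. [cite: DuminilCopinHammond2013, §2.4; MadrasSlade1993, Corollary 3.1.6] -/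
theorem bridgeNotBallistic_of_zeroForceSlope (d : ℕ)
    (h0 : ∀ v : ℝ, 0 < v → ∃ s : ℝ, 0 < s ∧
      pulledBridgeFreeEnergy (d + 1) (Real.exp s) < Real.log (connectiveConstant (d + 1)) + v * s)
    {v : ℝ} (hv : 0 < v) :
    ∃ c : ℝ, 0 < c ∧ ∃ n₀ : ℕ, ∀ n : ℕ, n₀ ≤ n →
      ((((bridges (d + 1) n).filter fun ω => v * (n : ℝ) ≤ ((ω n 0 : ℤ) : ℝ)).card : ℝ)) ≤
        Real.exp (-(c * n)) * (bridgeCount (d + 1) n : ℝ) := by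
  have hμ := connectiveConstant_pos (d + 1)
  obtain ⟨s, hs, hlt⟩ := h0 v hv
  obtain ⟨δ, hδ, hδn⟩ := bridge_span_tail_le_of_freeEnergy_lt d hs.le hlt
  obtain ⟨C₀, hC₀⟩ := exp_mul_pow_le_bridgeCount (d := d + 1)
  -- `μ^n ≤ e^{C √n} b_n` with `C = max C₀ 1 > 0`
  set C : ℝ := max C₀ 1 with hCdef
  have hC : 0 < C := lt_of_lt_of_le one_pos (le_max_right _ _)
  have hHW : ∀ n : ℕ, connectiveConstant (d + 1) ^ n ≤ Real.exp (C * Real.sqrt n) * bridgeCount (d + 1) n := by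
    intro n
    have h := hC₀ n
    have hsq : 0 ≤ Real.sqrt n := Real.sqrt_nonneg _
    have h1 : Real.exp (-(C₀ * Real.sqrt n)) * connectiveConstant (d + 1) ^ n ≤ bridgeCount (d + 1) n := h
    have h2 : connectiveConstant (d + 1) ^ n ≤ Real.exp (C₀ * Real.sqrt n) * bridgeCount (d + 1) n := by
      have := mul_le_mul_of_nonneg_left h1 (Real.exp_pos (C₀ * Real.sqrt n)).le
      rwa [← mul_assoc, ← Real.exp_add, add_neg_cancel, Real.exp_zero, one_mul] at this
    refine h2.trans (mul_le_mul_of_nonneg_right ?_ (Nat.cast_nonneg _))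
    exact Real.exp_le_exp.2 (mul_le_mul_of_nonneg_right (le_max_left _ _) hsq)
  -- choose `n₀` with `C √n ≤ (δ/2) n` for `n ≥ n₀`
  obtain ⟨n₀, hn₀⟩ := exists_nat_ge ((2 * C / δ) ^ 2)
  refine ⟨δ / 2, by positivity, max n₀ 1, fun n hn => ?_⟩
  have hn1 : 1 ≤ n := le_trans (le_max_right _ _) hn
  have hnn₀ : n₀ ≤ n := le_trans (le_max_left _ _) hn
  have hnR : ((2 * C / δ) ^ 2 : ℝ) ≤ n := hn₀.trans (by exact_mod_cast hnn₀)
  have hsqrt : 2 * C / δ ≤ Real.sqrt n := Real.le_sqrt_of_sq_le hnR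
  have hCn : C * Real.sqrt n ≤ δ / 2 * n := by
    have hs2 : Real.sqrt n * Real.sqrt n = n := Real.mul_self_sqrt (Nat.cast_nonneg n)
    have hC' : C ≤ δ / 2 * Real.sqrt n := by
      have := mul_le_mul_of_nonneg_left hsqrt (by positivity : (0 : ℝ) ≤ δ / 2)
      calc C = δ / 2 * (2 * C / δ) := by field_simp
        _ ≤ δ / 2 * Real.sqrt n := this
    calc C * Real.sqrt n ≤ δ / 2 * Real.sqrt n * Real.sqrt n :=
          mul_le_mul_of_nonneg_right hC' (Real.sqrt_nonneg _)
      _ = δ / 2 * n := by rw [mul_assoc, hs2]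
  calc ((((bridges (d + 1) n).filter fun ω => v * (n : ℝ) ≤ ((ω n 0 : ℤ) : ℝ)).card : ℝ))
      ≤ Real.exp (-(δ * n)) * connectiveConstant (d + 1) ^ n := hδn n hn1
    _ ≤ Real.exp (-(δ * n)) * (Real.exp (C * Real.sqrt n) * bridgeCount (d + 1) n) :=
        mul_le_mul_of_nonneg_left (hHW n) (Real.exp_pos _).le
    _ = Real.exp (-(δ * n) + C * Real.sqrt n) * bridgeCount (d + 1) n := by rw [Real.exp_add]; ring
    _ ≤ Real.exp (-(δ / 2 * n)) * bridgeCount (d + 1) n := by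
        refine mul_le_mul_of_nonneg_right (Real.exp_le_exp.2 ?_) (Nat.cast_nonneg _)
        linarith

end Zd

end Literature.Probability.RandomPlanarGeometry.SAW
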